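import Summits.NavierStokesRegularity.NavierStokesRegularity.Theorems.SoloRefuteLiuYong2026
import Mathlib.Analysis.SpecialFunctions.Gaussian.GaussianIntegral
import Literature.NumberTheory.LFunctions.GranvilleSoundararajanMeanSquare
import HarnessLib

/-!
# C138 `LiuYong2026` — downstream column: `¬ Step4_H1_upper` (and `¬ Step4_H1_abs`) as typed

Second-lineage object (ns-claims-refuter-6 g3, D-0090). NOT the token of record (`Step3_K41`, refuted by
`not_Step3_K41` in `Theorems.SoloRefuteLiuYong2026`, refuter-5 g3 — whose engine
`isClassicalNSSolutionOn_modulated_singleton` and mode `kay`/`pol` are reused here). It records that 引理H.1's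
inference «time-averaged K41 upper bound (+ infrared bound) ⇒ sup-in-time `H^s` bounds» (附录H p.57 L8–L17, used
at 命题4.4 p.18 L24–p.19 L4) is false AS TYPED in 定理1's forced data class. Witness: one Stokes mode with the
sparse-spike amplitude `a(t) = t·exp(−t⁸ sin²(πt))` (exact classical ⇒ global Leray–Hopf solution from
`u(0) = 0`, pressure 0, force `(a′ + 4π²a)·mode`); Jordan's inequality puts `a²` under Gaussian windows of mass
`4√(32π)/n²`, so `∫₀^∞ a² ≤ 1 + 8√(32π)` and the Cesàro spectrum is `Φ ≡ 0`; but `a(n) = n`, so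
`‖u(n)‖_{H⁰} ≥ ‖û(n)(k₀)‖ = n/2` and `UniformSobolevBounds` fails at `s = 0`. Unbounded kinetic energy: inside
the TYPED class (`IsData` + local-in-`T` Leray–Hopf), outside the print's literal 定理2.2 `L^∞_t L²_x` class.
Barrier of record: `Literature/Barriers/NavierStokesRegularity/CesaroSpectrumNoSupControl.lean`.
WHAT THIS IS NOT: not a claim about NS regularity or blow-up; not a claim about any author beyond the
typed locator.
-/

noncomputable section

set_option linter.dupNamespace false

open Set MeasureTheory Filter Topology intervalIntegral
open scoped ContDiff

namespace Summit.NavierStokesRegularity.NavierStokesRegularity.Theorems.LiuYong2026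

open Literature.Claims.NS.LiuYong2026
open Literature.Analysis Literature.Analysis.FluidPDE Literature.Analysis.FunctionSpaces
open Literature.Analysis.FunctionSpaces.Torus

namespace Spike

/-! ## The sparse-spike amplitude `a(t) = t·exp(−t⁸ sin²(πt))` -/

section Amplitude

/-- The sparse-spike amplitude: `a(n) = n` at every integer while `∫₀^∞ a² < ∞`. -/
def spike (t : ℝ) : ℝ := t * Real.exp (-(t ^ 8 * Real.sin (Real.pi * t) ^ 2))

/-- The spike amplitude is smooth on `ℝ`. -/
theorem contDiff_spike : ContDiff ℝ ∞ spike := by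
  unfold spike
  exact contDiff_id.mul (Real.contDiff_exp.comp
    ((contDiff_id.pow 8).mul ((Real.contDiff_sin.comp (contDiff_const.mul contDiff_id)).pow 2)).neg)

/-- `a(n) = n` at every natural number (the spikes). -/
theorem spike_nat (n : ℕ) : spike n = n := by
  have h : Real.sin (Real.pi * n) = 0 := by rw [mul_comm]; exact Real.sin_nat_mul_pi n
  simp [spike, h]

/-- `a(t)² = t²·exp(−2t⁸sin²(πt))`. -/
theorem spike_sq (t : ℝ) :
    spike t ^ 2 = t ^ 2 * Real.exp (-(2 * (t ^ 8 * Real.sin (Real.pi * t) ^ 2))) := by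
  rw [spike, mul_pow, sq (Real.exp _), ← Real.exp_add]
  ring_nf

/-- Jordan's inequality in squared form: `4 s² ≤ sin²(π s)` for `|s| ≤ 1/2`. -/
theorem four_mul_sq_le_sin_sq {s : ℝ} (hs : |s| ≤ 1 / 2) :
    4 * s ^ 2 ≤ Real.sin (Real.pi * s) ^ 2 := by
  have hπ := Real.pi_pos
  have h1 : 2 * |s| ≤ Real.sin (Real.pi * |s|) := by
    have hle : Real.pi * |s| ≤ Real.pi / 2 := by
      have := mul_le_mul_of_nonneg_left hs hπ.le
      linarith
    have h := Real.mul_le_sin (x := Real.pi * |s|) (by positivity) hle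
    calc 2 * |s| = 2 / Real.pi * (Real.pi * |s|) := by field_simp
      _ ≤ _ := h
  have h2 : Real.sin (Real.pi * |s|) ^ 2 = Real.sin (Real.pi * s) ^ 2 := by
    rcases abs_choice s with h | h
    · rw [h]
    · rw [h, mul_neg, Real.sin_neg, neg_sq]
  have h3 : 0 ≤ 2 * |s| := by positivity
  calc 4 * s ^ 2 = (2 * |s|) ^ 2 := by rw [mul_pow, sq_abs]; norm_num
    _ ≤ Real.sin (Real.pi * |s|) ^ 2 := pow_le_pow_left₀ h3 h1 2
    _ = _ := h2

/-- On the unit window around the integer `n ≥ 1` the squared amplitude sits under a Gaussian of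
height `4n²` and variance `∼ n⁻⁸`. -/
theorem spike_sq_le_gauss {n : ℕ} (hn : 1 ≤ n) {t : ℝ}
    (ht : t ∈ Icc ((n : ℝ) - 1 / 2) ((n : ℝ) + 1 / 2)) :
    spike t ^ 2 ≤ 4 * (n : ℝ) ^ 2 * Real.exp (-((n : ℝ) ^ 8 / 32) * (t - n) ^ 2) := by
  obtain ⟨ht1, ht2⟩ := ht
  have hn1 : (1 : ℝ) ≤ n := by exact_mod_cast hn
  have ht0 : 0 ≤ t := by linarith
  have htn : (n : ℝ) / 2 ≤ t := by linarith
  have hsin : Real.sin (Real.pi * t) ^ 2 = Real.sin (Real.pi * (t - n)) ^ 2 := by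
    have h : Real.pi * t = Real.pi * (t - n) + n * Real.pi := by ring
    rw [h, Real.sin_add_nat_mul_pi, mul_pow, ← pow_mul, mul_comm n 2, pow_mul]
    norm_num
  have hjordan : 4 * (t - n) ^ 2 ≤ Real.sin (Real.pi * t) ^ 2 := by
    rw [hsin]
    exact four_mul_sq_le_sin_sq (by rw [abs_le]; constructor <;> linarith)
  have ht8 : (n : ℝ) ^ 8 / 256 ≤ t ^ 8 := by
    have h : ((n : ℝ) / 2) ^ 8 ≤ t ^ 8 := pow_le_pow_left₀ (by positivity) htn 8
    calc (n : ℝ) ^ 8 / 256 = ((n : ℝ) / 2) ^ 8 := by ring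
      _ ≤ t ^ 8 := h
  have hexp : -(2 * (t ^ 8 * Real.sin (Real.pi * t) ^ 2)) ≤ -((n : ℝ) ^ 8 / 32) * (t - n) ^ 2 := by
    have h := mul_le_mul ht8 hjordan (by positivity) (by positivity)
    nlinarith [h]
  have ht2' : t ^ 2 ≤ 4 * (n : ℝ) ^ 2 := by nlinarith [ht1, ht2, hn1, ht0]
  rw [spike_sq]
  exact mul_le_mul ht2' (Real.exp_le_exp.mpr hexp) (Real.exp_pos _).le (by positivity)

/-- Each unit window `[k + ½, k + 3/2]` contributes at most `4√(32π)/(k+1)²` to `∫ a²`. -/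
theorem integral_spike_sq_window (k : ℕ) :
    ∫ t in ((k : ℝ) + 1 / 2)..((k : ℝ) + 1 + 1 / 2), spike t ^ 2 ≤
      4 * Real.sqrt (32 * Real.pi) / ((k : ℝ) + 1) ^ 2 := by
  have hcast : ((k + 1 : ℕ) : ℝ) = (k : ℝ) + 1 := by push_cast; ring
  set m : ℝ := (k : ℝ) + 1 with hm
  have hm1 : (1 : ℝ) ≤ m := by
    have : (0 : ℝ) ≤ k := Nat.cast_nonneg k
    linarith
  have hm0 : 0 < m := by linarith
  set b : ℝ := m ^ 8 / 32 with hb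
  have hbpos : 0 < b := by positivity
  set G : ℝ → ℝ := fun t => 4 * m ^ 2 * Real.exp (-b * (t - m) ^ 2) with hG
  have hGint : Integrable G :=
    ((integrable_exp_neg_mul_sq hbpos).comp_sub_right m).const_mul (4 * m ^ 2)
  have hlo : (k : ℝ) + 1 / 2 = m - 1 / 2 := by rw [hm]; ring
  have hhi : (k : ℝ) + 1 + 1 / 2 = m + 1 / 2 := by rw [hm]
  rw [hlo, hhi]
  have hle : m - 1 / 2 ≤ m + 1 / 2 := by linarith
  have h1 : ∫ t in (m - 1 / 2)..(m + 1 / 2), spike t ^ 2 ≤ ∫ t in (m - 1 / 2)..(m + 1 / 2), G t := by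
    refine intervalIntegral.integral_mono_on hle ((contDiff_spike.continuous.pow 2).intervalIntegrable _ _)
      hGint.intervalIntegrable fun t ht => ?_
    have h := spike_sq_le_gauss (n := k + 1) (by omega) (t := t) (by rwa [hcast])
    rwa [hcast] at h
  have h2 : ∫ t in (m - 1 / 2)..(m + 1 / 2), G t ≤ ∫ t, G t := by
    rw [intervalIntegral.integral_of_le hle]
    exact setIntegral_le_integral hGint (Eventually.of_forall fun t => by positivity)
  have h3 : ∫ t, G t = 4 * Real.sqrt (32 * Real.pi) / m ^ 2 := by
    have hs : ∫ t : ℝ, Real.exp (-b * (t - m) ^ 2) = Real.sqrt (Real.pi / b) := by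
      rw [integral_sub_right_eq_self (fun t => Real.exp (-b * t ^ 2)) m]
      exact integral_gaussian b
    rw [hG, MeasureTheory.integral_const_mul, hs]
    have hπb : Real.pi / b = (32 * Real.pi) / (m ^ 4) ^ 2 := by
      rw [hb]; field_simp
    rw [hπb, Real.sqrt_div (by positivity), Real.sqrt_sq (by positivity)]
    field_simp
  exact h1.trans (h2.trans h3.le)

/-- **Uniform bound on the time integral of `a²`**: `∫₀ᵀ a(t)² dt ≤ 1 + 8√(32π)` for all `T ≥ 0`. -/
theorem integral_spike_sq_le {T : ℝ} (hT : 0 ≤ T) :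
    ∫ t in (0 : ℝ)..T, spike t ^ 2 ≤ 1 + 8 * Real.sqrt (32 * Real.pi) := by
  have hii : ∀ a b : ℝ, IntervalIntegrable (fun t => spike t ^ 2) volume a b := fun a b =>
    (contDiff_spike.continuous.pow 2).intervalIntegrable a b
  set N : ℕ := ⌈T⌉₊ with hN
  have hTN : T ≤ (N : ℝ) + 1 / 2 := (Nat.le_ceil T).trans (by linarith)
  -- monotonicity in the upper limit
  have h1 : ∫ t in (0 : ℝ)..T, spike t ^ 2 ≤ ∫ t in (0 : ℝ)..((N : ℝ) + 1 / 2), spike t ^ 2 :=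
    intervalIntegral.integral_mono_interval le_rfl hT hTN
      (Eventually.of_forall fun t => sq_nonneg (spike t)) (hii _ _)
  -- split at 1/2 and into unit windows
  have h2 : ∫ t in (0 : ℝ)..((N : ℝ) + 1 / 2), spike t ^ 2 =
      (∫ t in (0 : ℝ)..(1 / 2), spike t ^ 2) +
        ∑ k ∈ Finset.range N, ∫ t in ((k : ℝ) + 1 / 2)..(((k + 1 : ℕ) : ℝ) + 1 / 2), spike t ^ 2 := by
    rw [intervalIntegral.sum_integral_adjacent_intervals (a := fun k : ℕ => (k : ℝ) + 1 / 2)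
      (fun k _ => hii _ _)]
    simp only [Nat.cast_zero, zero_add]
    exact (intervalIntegral.integral_add_adjacent_intervals (hii _ _) (hii _ _)).symm
  have h3 : ∫ t in (0 : ℝ)..(1 / 2), spike t ^ 2 ≤ 1 := by
    have h : ∫ t in (0 : ℝ)..(1 / 2), spike t ^ 2 ≤ ∫ _ in (0 : ℝ)..(1 / 2), (1 : ℝ) := by
      refine intervalIntegral.integral_mono_on (by norm_num) (hii _ _) intervalIntegrable_const
        fun t ht => ?_
      obtain ⟨ht0, ht1⟩ := ht
      rw [spike_sq]
      have he : Real.exp (-(2 * (t ^ 8 * Real.sin (Real.pi * t) ^ 2))) ≤ 1 :=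
        Real.exp_le_one_iff.mpr (by nlinarith [sq_nonneg (t ^ 4 * Real.sin (Real.pi * t))])
      nlinarith [Real.exp_pos (-(2 * (t ^ 8 * Real.sin (Real.pi * t) ^ 2))), sq_nonneg t]
    rw [intervalIntegral.integral_const, smul_eq_mul, mul_one] at h
    linarith
  have h4 : ∑ k ∈ Finset.range N, ∫ t in ((k : ℝ) + 1 / 2)..(((k + 1 : ℕ) : ℝ) + 1 / 2), spike t ^ 2 ≤
      8 * Real.sqrt (32 * Real.pi) := by
    calc ∑ k ∈ Finset.range N, ∫ t in ((k : ℝ) + 1 / 2)..(((k + 1 : ℕ) : ℝ) + 1 / 2), spike t ^ 2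
        ≤ ∑ k ∈ Finset.range N, 4 * Real.sqrt (32 * Real.pi) / ((k : ℝ) + 1) ^ 2 := by
          refine Finset.sum_le_sum fun k _ => ?_
          have h := integral_spike_sq_window k
          push_cast
          exact h
      _ = 4 * Real.sqrt (32 * Real.pi) * ∑ k ∈ Finset.range N, 1 / ((k : ℝ) + 1) ^ 2 := by
          rw [Finset.mul_sum]
          refine Finset.sum_congr rfl fun k _ => ?_
          ring
      _ ≤ 4 * Real.sqrt (32 * Real.pi) * 2 :=
          mul_le_mul_of_nonneg_left
            (Literature.NumberTheory.LFunctions.GranvilleSoundararajan.sum_range_inv_succ_sq_le N)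
            (by positivity)
      _ = 8 * Real.sqrt (32 * Real.pi) := by ring
  linarith

/-- Hence the Cesàro means of `a²` vanish: `T⁻¹ ∫₀ᵀ a² → 0`. -/
theorem tendsto_cesaro_spike_sq :
    Tendsto (fun T : ℝ => T⁻¹ * ∫ t in (0 : ℝ)..T, spike t ^ 2) atTop (𝓝 0) := by
  set M : ℝ := 1 + 8 * Real.sqrt (32 * Real.pi) with hM
  have hup : Tendsto (fun T : ℝ => M * T⁻¹) atTop (𝓝 0) := by
    simpa using tendsto_inv_atTop_zero.const_mul M
  refine tendsto_of_tendsto_of_tendsto_of_le_of_le' tendsto_const_nhds hup ?_ ?_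
  · filter_upwards [eventually_gt_atTop (0 : ℝ)] with T hT
    exact mul_nonneg (inv_nonneg.mpr hT.le)
      (intervalIntegral.integral_nonneg hT.le fun t _ => sq_nonneg (spike t))
  · filter_upwards [eventually_gt_atTop (0 : ℝ)] with T hT
    rw [mul_comm]
    exact mul_le_mul_of_nonneg_right (integral_spike_sq_le hT.le) (inv_nonneg.mpr hT.le)

end Amplitude

/-! ## The witness: one Stokes mode (`kay`, `pol` of the landed file) carrying the spike amplitude -/

section Witness

/-- `k₀ ≠ −k₀` for the landed wave vector `k₀ = (0,1,0)` (`kay`). -/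
theorem kay_ne_neg : kay ≠ -kay := fun h => by simpa [kay] using congrFun h 1

/-- The landed polarisation `pol ≡ e₀` is orthogonal to `k₀`: `k₀·z = 0`. -/
theorem kay_orth : ∑ j, (kay j : ℂ) * pol kay j = 0 := by
  simp [kay, pol, Pi.single_apply]

/-- The spatial mode `w = Re(e₀ e^{2πi x₁})`. -/
def spikeMode : T3 → E3 := realTrigPoly {kay} pol

/-- The witness velocity `u(t,x) = a(t) w(x)`. -/
def spikeVel (t : ℝ) (x : T3) : E3 := spike t • spikeMode x

/-- Its force `(a′ + 4π²|k₀|² a) w` (viscosity `ν = 1`; `a′` taken within `[0,∞)`). -/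
def spikeFrc (t : ℝ) (x : T3) : E3 :=
  (derivWithin spike (Ici 0) t + 1 * (4 * Real.pi ^ 2 * freqNormSq kay) * spike t) • spikeMode x

/-- The witness is an exact classical solution of the forced system on `[0,∞) × 𝕋³` (pressure `0`), by the
landed modulated-mode lemma of `Theorems.SoloRefuteLiuYong2026` (refuter-5 g3). -/
theorem isClassical_spikeVel : Torus.IsClassicalNSSolutionOn (Ici 0) 1 spikeFrc spikeVel (fun _ _ => 0) :=
  isClassicalNSSolutionOn_modulated_singleton 1 kay_orth contDiff_spike.contDiffOn

/-- Hence a global Leray–Hopf solution from its initial slice `u 0` (`= 0`, since `a(0) = 0`). -/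
theorem isGlobalLerayHopf_spikeVel : Torus.IsGlobalLerayHopf 1 spikeFrc (spikeVel 0) spikeVel :=
  fun _ hT => isClassical_spikeVel.isLerayHopfOn_of_convex (convex_Ici 0) hT Icc_subset_Ici_self

/-- The data `(ν, f, u₀) = (1, spikeFrc, spikeVel 0)` lie in the data class of Thm 1. -/
theorem isData_spikeVel : IsData 1 spikeFrc (spikeVel 0) where
  visc := one_pos
  force_smooth := by
    have hθ : ContDiffOn ℝ ∞
        (fun t : ℝ => derivWithin spike (Ici 0) t + 1 * (4 * Real.pi ^ 2 * freqNormSq kay) * spike t)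
        (Ici 0) :=
      ((contDiffOn_infty_iff_derivWithin (uniqueDiffOn_Ici 0)).1 contDiff_spike.contDiffOn).2.add
        (contDiffOn_const.mul contDiff_spike.contDiffOn)
    exact (isSmoothSpaceTimeOn_of_time hθ).smul
      (isSmoothSpaceTimeOn_const (isSmooth_realTrigPoly {kay} pol) _)
  force_divFree t _ :=
    Torus.isDivFree_const_smul ((isSmooth_realTrigPoly {kay} pol).isContDiff (by simp))
      (isDivFree_realTrigPoly_singleton kay_orth) _
  datum_smooth := (isSmooth_realTrigPoly {kay} pol).smul (spike 0)
  datum_divFree :=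
    Torus.isDivFree_const_smul ((isSmooth_realTrigPoly {kay} pol).isContDiff (by simp))
      (isDivFree_realTrigPoly_singleton kay_orth) _

/-! ### Mode energies and the Cesàro spectrum `Φ ≡ 0` -/

/-- `coeff` is real-homogeneous: `𝓕(a v)(k) = a 𝓕(v)(k)`. -/
theorem coeff_smul (a : ℝ) (v : T3 → E3) (k : Z3) :
    coeff (fun x => a • v x) k = (a : ℂ) • coeff v k := by
  unfold coeff
  have h : (EuclideanSpace.complexify ∘ fun x => a • v x) =
      (a : ℂ) • (EuclideanSpace.complexify ∘ v) := by
    funext x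
    simp only [Function.comp_apply, Pi.smul_apply, map_smul, Complex.coe_smul]
  rw [h, mFourierCoeff_const_smul]

/-- Mode energies scale quadratically: `E_k(a v) = a² E_k(v)`. -/
theorem modeEnergy_smul (a : ℝ) (v : T3 → E3) (k : Z3) :
    modeEnergy (fun x => a • v x) k = a ^ 2 * modeEnergy v k := by
  rw [modeEnergy, modeEnergy, coeff_smul, norm_smul, Complex.norm_real, Real.norm_eq_abs, mul_pow,
    sq_abs]
  ring

/-- Mode energies of the witness factor through `a(t)²`. -/
theorem modeEnergy_spikeVel (t : ℝ) (k : Z3) :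
    modeEnergy (spikeVel t) k = spike t ^ 2 * modeEnergy spikeMode k :=
  modeEnergy_smul (spike t) spikeMode k

/-- The witness HAS a Cesàro spectrum, namely `Φ ≡ 0` (`∫₀^∞ a² < ∞`). -/
theorem hasCesaroSpectrum_spikeVel : HasCesaroSpectrum spikeVel (fun _ => 0) := by
  intro k _
  have h : (fun T : ℝ => T⁻¹ * ∫ t in (0 : ℝ)..T, modeEnergy (spikeVel t) k) =
      fun T => modeEnergy spikeMode k * (T⁻¹ * ∫ t in (0 : ℝ)..T, spike t ^ 2) := by
    funext T
    simp_rw [modeEnergy_spikeVel]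
    rw [intervalIntegral.integral_mul_const]
    ring
  rw [h]
  simpa using tendsto_cesaro_spike_sq.const_mul (modeEnergy spikeMode k)

/-! ### No uniform `H⁰` bound: `‖u(n)‖_{H⁰} ≥ ‖û(n)(k₀)‖ = n/2` -/

/-- The `k₀`-coefficient of the mode: `𝓕(w)(k₀) = z/2`. -/
theorem coeff_spikeMode_kay : coeff spikeMode kay = (2 : ℂ)⁻¹ • pol kay := by
  unfold coeff spikeMode
  rw [mFourierCoeff_realTrigPoly_singleton, if_pos rfl, if_neg kay_ne_neg, EuclideanSpace.conjVec_zero,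
    add_zero]

/-- `‖𝓕(w)(k₀)‖ = 1/2`. -/
theorem norm_coeff_spikeMode_kay : ‖coeff spikeMode kay‖ = 1 / 2 := by
  rw [coeff_spikeMode_kay, norm_smul, pol, PiLp.norm_single]
  simp

/-- At the spike times `t = n`: `‖𝓕(u(n))(k₀)‖ = n/2`. -/
theorem norm_coeff_spikeVel_nat (n : ℕ) : ‖coeff (spikeVel n) kay‖ = (n : ℝ) / 2 := by
  have h : coeff (spikeVel n) kay = ((n : ℝ) : ℂ) • coeff spikeMode kay := by
    show coeff (fun x => spike n • spikeMode x) kay = _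
    rw [spike_nat]
    exact coeff_smul (n : ℝ) spikeMode kay
  rw [h, norm_smul, Complex.norm_real, Real.norm_eq_abs, abs_of_nonneg (Nat.cast_nonneg n),
    norm_coeff_spikeMode_kay]
  ring

/-- A single Fourier coefficient bounds the `H⁰` norm from below. -/
theorem enorm_coeff_le_eSobolevNorm_zero (v : T3 → E3) (k : Z3) :
    ‖coeff v k‖ₑ ≤ Torus.eSobolevNorm 0 (EuclideanSpace.complexify ∘ v) := by
  unfold Torus.eSobolevNorm coeff
  have h1 : ‖UnitAddTorus.mFourierCoeff (EuclideanSpace.complexify ∘ v) k‖ₑ =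
      (ENNReal.ofReal (sobolevWeight 0 k ^ 2) *
        ‖UnitAddTorus.mFourierCoeff (EuclideanSpace.complexify ∘ v) k‖ₑ ^ 2) ^ (1 / 2 : ℝ) := by
    rw [sobolevWeight_zero, one_pow, ENNReal.ofReal_one, one_mul, ← ENNReal.rpow_natCast,
      ← ENNReal.rpow_mul]
    norm_num
  rw [h1]
  exact ENNReal.rpow_le_rpow (ENNReal.le_tsum k) (by norm_num)

/-- **The witness violates `UniformSobolevBounds` already at `s = 0`.** -/
theorem not_uniformSobolevBounds_spikeVel : ¬ UniformSobolevBounds spikeVel := by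
  intro h
  obtain ⟨C, hC⟩ := h 0 le_rfl
  have key : ∀ n : ℕ, (n : ℝ) ^ 2 / 4 ≤ C ∨ (n : ℝ) ^ 2 / 4 ≤ 0 := fun n => by
    have h1 := hC n (Nat.cast_nonneg n)
    have h2 : ENNReal.ofReal ((n : ℝ) ^ 2 / 4) ≤
        Torus.eSobolevNorm 0 (EuclideanSpace.complexify ∘ spikeVel n) ^ 2 := by
      have hsq : ENNReal.ofReal ((n : ℝ) ^ 2 / 4) = ‖coeff (spikeVel n) kay‖ₑ ^ 2 := by
        rw [← ofReal_norm, norm_coeff_spikeVel_nat, ← ENNReal.ofReal_pow (by positivity)]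
        congr 1
        ring
      rw [hsq]
      exact pow_le_pow_left' (enorm_coeff_le_eSobolevNorm_zero (spikeVel n) kay) 2
    exact ENNReal.ofReal_le_ofReal_iff'.mp (h2.trans h1)
  obtain ⟨n, hn⟩ := exists_nat_gt (4 * |C| + 4)
  rcases key n with h | h <;> nlinarith [abs_nonneg C, le_abs_self C, hn]

end Witness

end Spike

/-! ## The kills -/

section Kills

open Spike

/-- **`Step4_H1_upper` (引理H.1 at the grain its proof uses, p.57 L13; 命题4.4 p.18 L24–p.19 L4) is false as
typed**: in the data class of 定理1 (smooth divergence-free force and datum, `ν = 1`) the global Leray–Hopf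
solution `u = a(t)·Re(e₀e^{2πix₁})`, `a(t) = t·exp(−t⁸sin²(πt))`, HAS a Cesàro spectrum (`Φ ≡ 0`, K41-upper
and infrared bounded) and yet `sup_{t ≥ 0} ‖u(t)‖_{H⁰} = ∞` (`a(n) = n`): a time-averaged spectrum bound does
not control `sup_t`. [cite: LiuYong2026, 附录H 引理H.1 p.57 L8–L17] -/
theorem not_Step4_H1_upper : ¬ Step4_H1_upper := fun h =>
  not_uniformSobolevBounds_spikeVel
    (h 1 spikeFrc (spikeVel 0) isData_spikeVel spikeVel (fun _ => 0) isGlobalLerayHopf_spikeVel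
      hasCesaroSpectrum_spikeVel ⟨0, 0, fun k _ => by simp⟩ ⟨0, fun _ => le_rfl⟩)

/-- Hence the abstract face `Step4_H1_abs` (引理H.1 exactly as printed, p.57 L8–L17) is false too
(`step4_upper_of_abs`). [cite: LiuYong2026, 附录H 引理H.1 p.57 L8–L17] -/
theorem not_Step4_H1_abs : ¬ Step4_H1_abs := fun h => not_Step4_H1_upper (step4_upper_of_abs h)

example : ¬ Literature.Claims.NS.LiuYong2026.Step4_H1_upper := not_Step4_H1_upper
example : ¬ Literature.Claims.NS.LiuYong2026.Step4_H1_abs := not_Step4_H1_abs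

end Kills

end Summit.NavierStokesRegularity.NavierStokesRegularity.Theorems.LiuYong2026

end
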